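import Literature.Computability.Complexity.TFNPProblems
import HarnessLib

/-!
# The canonical total search problems II: LOCALOPT, the classes `PPAD`, `PLS`, `EOPL`, and the
# collapse `EOPL = PLS ∩ PPAD` (Göös–Hollender–Jain–Maystre–Pires–Robere–Tao 2022)

Continuation of `TFNPProblems.lean` (conventions, END-OF-LINE, END-OF-POTENTIAL-LINE) announced
there; cite/fact item `wi-23815` ("EOPL = CLS = PPAD ∩ PLS"), wanted by route
`PneNP/ArnoldMorseDeficit` (crux `EoplToMorseDeficit`: CLS-hardness through END-OF-POTENTIAL-LINE).

* `TFNP.LocalOpt` — **LOCALOPT** (Johnson–Papadimitriou–Yannakakis 1988; in the rendering of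
  Fearnley–Goldberg–Hollender–Savani 2022, §3.1.2, Def. 2: "Input: Boolean circuits
  `S, V : [2ⁿ] → [2ⁿ]`. Goal: Find `v ∈ [2ⁿ]` such that `V(S(v)) ≥ V(v)`"), as
  `TFNP.ofCircuits` with data `[S, V]`, `valid` = well-formedness (`S` has `n` outputs; no side
  condition is printed), solutions the strings `x ∈ {0,1}ⁿ` with `V(S x) ≥ V(x)` (values read by
  `bitsToNat`).  PROVED: `LocalOpt.isTotal` (a minimiser of `V` over `{0,1}ⁿ` is a solution) and
  `LocalOpt.isPolyBalanced`.
* The classes, each "the set of all TFNP problems that reduce to" its presenting problem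
  (`TFNP.closureOf`, `TotalSearchProblem.lean`): `PPAD := closureOf END-OF-LINE` (FGHS 2022,
  §3.1.2, Def. 1; Papadimitriou 1994), `PLS := closureOf LOCALOPT` (FGHS 2022, §3.1.2, Def. 2;
  JPY 1988), `EOPL := closureOf END-OF-POTENTIAL-LINE` (Fearnley–Gordon–Mehta–Savani 2020, Def. 9;
  GHJMPRT 2022, p. 1: "the class EOPL consists of all total search problems that reduce to the
  End-of-Potential-Line problem").
* NAMED FACT `EOPL_eq_PLS_inter_PPAD` (now in `TFNPCollapse.lean`, refactor `wi-38313`) — **Göös et al. (2022), Thm. 1: `EOPL = PLS ∩ PPAD`.**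

**On `CLS`.**  Daskalakis–Papadimitriou's `CLS` is presented by CONTINUOUS-LOCALOPT (functions on
`[0,1]³` given by *arithmetic* circuits, Lipschitz constants, an accuracy `ε`; FGHS 2022 §3.1.3);
the tree has no arithmetic-circuit vocabulary and `CLS` is NOT defined here.  By
Fearnley–Goldberg–Hollender–Savani (2022), Thm. 1.1 (`CLS = PPAD ∩ PLS`) and the fact below,
`CLS = EOPL`; consumers needing "`CLS`-hardness" (route `ArnoldMorseDeficit`) work with `EOPL`,
i.e. reduce from END-OF-POTENTIAL-LINE, exactly as the item's informal statement does
("END-OF-POTENTIAL-LINE is complete for CLS … and CLS = PPAD ∩ PLS").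

**Reductions.**  The sources use polynomial-time many-one reductions between promise-free problems
whose side conditions are "enforced syntactically"; the tree's `SearchProblem.ManyOneReducible` is
the promise-preserving form over problems carrying the side condition as a `P`-decidable promise
`valid` — many-one equivalent to the printed form (`SearchProblemTotalize.lean`,
`R ≤ₘ R.totalize ≤ₘ R`, given `valid ∈ P`; that `valid, rel ∈ P` for the circuit problems is the
stack-program exercise left open in `TFNPProblems.lean`).

## References

* M. Göös, A. Hollender, S. Jain, G. Maystre, W. Pires, R. Robere, R. Tao, *Further collapses in
  TFNP*, CCC 2022 (LIPIcs 234) = arXiv:2202.07761: Thm. 1 (`EOPL = PLS ∩ PPAD`), §1 (the classes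
  via canonical complete problems), §5. [GoosEtAl2022FurtherCollapses]
* J. Fearnley, P. Goldberg, A. Hollender, R. Savani, *The complexity of gradient descent:
  CLS = PPAD ∩ PLS*, J. ACM 70 (2022/23) = arXiv:2011.01929: §3.1.1 (reductions), §3.1.2 Def. 1
  (END-OF-LINE, `PPAD`), Def. 2 (LOCALOPT, `PLS`), Def. 3 (ITER), Thm. 1.1 (`CLS = PPAD ∩ PLS`).
  [FearnleyGoldbergHollenderSavani2022]
* J. Fearnley, S. Gordon, R. Mehta, R. Savani, *Unique end of potential line*, JCSS 114 (2020) =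
  arXiv:1811.03841, Def. 9 (END-OF-POTENTIAL-LINE, `EOPL`). [FearnleyGordonMehtaSavani2020]
* D. Johnson, C. Papadimitriou, M. Yannakakis, *How easy is local search?*, JCSS 37 (1988)
  (`PLS`). [JohnsonPapadimitriouYannakakis1988]
* C. Daskalakis, C. Papadimitriou, *Continuous local search*, SODA 2011 (`CLS`).
  [DaskalakisPapadimitriou2011]
-/

namespace Literature.Computability.Complexity

open _root_.Computability

namespace TFNP

/-! ### LOCALOPT -/

/-- Well-formedness of a LOCALOPT instance `(n, [S, V])`: the neighbourhood circuit `S` has `n`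
output bits (the value circuit `V` may have any number of output bits, read by `bitsToNat`).  No
side condition is printed for LOCALOPT. [FGHS 2022, §3.1.2, Def. 2]
[cite: FearnleyGoldbergHollenderSavani2022, §3.1.2 Def. 2] -/
def LocalOpt.IsValid (n : ℕ) : List (List (List Bool)) → Prop
  | [S, _V] => S.length = n
  | _ => False

/-- Solutions of LOCALOPT: a node `x ∈ {0,1}ⁿ` with `V(S(x)) ≥ V(x)` (the proposed neighbour does
not improve the value). [FGHS 2022, §3.1.2, Def. 2 ("Find `v` such that `V(S(v)) ≥ V(v)`")]
[cite: FearnleyGoldbergHollenderSavani2022, §3.1.2 Def. 2] -/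
def LocalOpt.IsSolution (n : ℕ) : List (List (List Bool)) → List Bool → Prop
  | [S, V], x => x.length = n ∧ bitsToNat (evalBits V x) ≤ bitsToNat (evalBits V (evalBits S x))
  | _, _ => False

/-- **LOCALOPT.** Given circuits `S : {0,1}ⁿ → {0,1}ⁿ` (neighbour) and `V` (value), find `x` with
`V(S(x)) ≥ V(x)`.  The presenting problem of `PLS` (Johnson–Papadimitriou–Yannakakis 1988;
Fearnley–Goldberg–Hollender–Savani 2022, §3.1.2, Def. 2).
[cite: FearnleyGoldbergHollenderSavani2022, §3.1.2 Def. 2] -/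
def LocalOpt : SearchProblem :=
  ofCircuits LocalOpt.IsValid LocalOpt.IsSolution

/-- LOCALOPT is polynomially balanced (solutions have length `n`). [folklore] -/
theorem LocalOpt.isPolyBalanced : LocalOpt.IsPolyBalanced := by
  refine ofCircuits_isPolyBalanced 1 fun n Cs x h => ?_
  match Cs, h with
  | [S, V], h => simp only [LocalOpt.IsSolution] at h; omega

/-- **LOCALOPT is total**: a node `x ∈ {0,1}ⁿ` minimising the value `V(x)` over the finite vertex
set satisfies `V(S(x)) ≥ V(x)` (`S(x) ∈ {0,1}ⁿ` by well-formedness). [FGHS 2022, §3.1.2 ("ideally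
we would like to find a node `v ∈ [2ⁿ]` that minimises `V(v)` … We stop our search, when we find a
`v` such that `V(S(v)) ≥ V(v)`")] [cite: FearnleyGoldbergHollenderSavani2022, §3.1.2 Def. 2] -/
theorem LocalOpt.isTotal : LocalOpt.IsTotal := by
  classical
  refine ofCircuits_isTotal_iff.2 fun n Cs hV => ?_
  match Cs, hV with
  | [S, V], hS =>
    simp only [LocalOpt.IsValid] at hS
    -- minimise `V` over the (finite, nonempty) set of strings of length `n`
    let f : List.Vector Bool n → ℕ := fun v => bitsToNat (evalBits V v.1)
    obtain ⟨v, -, hv⟩ := Finset.exists_min_image Finset.univ f ⟨⟨zero n, length_zero n⟩, Finset.mem_univ _⟩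
    refine ⟨v.1, ?_⟩
    simp only [LocalOpt.IsSolution]
    refine ⟨v.2, ?_⟩
    have hlen : (evalBits S v.1).length = n := by rw [length_evalBits, hS]
    exact hv ⟨evalBits S v.1, hlen⟩ (Finset.mem_univ _)

end TFNP

/-! ### The classes `PPAD`, `PLS`, `EOPL` -/

/-- **`PPAD`**: "the set of all TFNP problems that reduce to the problem END-OF-LINE"
(Papadimitriou 1994; Fearnley–Goldberg–Hollender–Savani 2022, §3.1.2, Def. 1), as the syntactic
subclass `TFNP.closureOf TFNP.EndOfLine`. [cite: FearnleyGoldbergHollenderSavani2022, §3.1.2 Def. 1] -/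
def PPAD : Set SearchProblem :=
  TFNP.closureOf TFNP.EndOfLine

/-- **`PLS`**: "the set of all TFNP problems that reduce to the problem LOCALOPT"
(Johnson–Papadimitriou–Yannakakis 1988; Fearnley–Goldberg–Hollender–Savani 2022, §3.1.2, Def. 2),
as `TFNP.closureOf TFNP.LocalOpt`. [cite: FearnleyGoldbergHollenderSavani2022, §3.1.2 Def. 2] -/
def PLS : Set SearchProblem :=
  TFNP.closureOf TFNP.LocalOpt

/-- **`EOPL`**: "the class EOPL consists of all total search problems that reduce to the
End-of-Potential-Line problem" (Göös et al. 2022, p. 1; Fearnley–Gordon–Mehta–Savani 2020,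
Def. 9 and §2), as `TFNP.closureOf TFNP.EndOfPotentialLine`.  By FGHS (2022), Thm. 1.1 and
`EOPL_eq_PLS_inter_PPAD` it coincides with Daskalakis–Papadimitriou's `CLS` (not defined in the
tree). [cite: GoosEtAl2022FurtherCollapses, §1 (p. 1)] [cite: FearnleyGordonMehtaSavani2020, Def. 9] -/
def EOPL : Set SearchProblem :=
  TFNP.closureOf TFNP.EndOfPotentialLine

/-- `PPAD ⊆ TFNP`. [cite: FearnleyGoldbergHollenderSavani2022, §3.1.2] -/
theorem PPAD_subset_TFNP : PPAD ⊆ TFNP :=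
  TFNP.closureOf_subset_TFNP _

/-- `PLS ⊆ TFNP`. [cite: FearnleyGoldbergHollenderSavani2022, §3.1.2] -/
theorem PLS_subset_TFNP : PLS ⊆ TFNP :=
  TFNP.closureOf_subset_TFNP _

/-- `EOPL ⊆ TFNP`. [cite: GoosEtAl2022FurtherCollapses, §1] -/
theorem EOPL_subset_TFNP : EOPL ⊆ TFNP :=
  TFNP.closureOf_subset_TFNP _

/-- A `TFNP` problem to which END-OF-POTENTIAL-LINE-hardness is transferred, i.e. one that
END-OF-POTENTIAL-LINE reduces to, is `EOPL`-hard: every `EOPL` problem reduces to it (transitivity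
of `≤ₘ`). The shape in which route `ArnoldMorseDeficit` uses "CLS-hardness". [folklore] -/
theorem manyOneReducible_of_mem_EOPL_of_endOfPotentialLine_reducible {R X : SearchProblem}
    (hR : R ∈ EOPL) (hX : TFNP.EndOfPotentialLine.ManyOneReducible X) : R.ManyOneReducible X :=
  hR.2.trans hX

/-! ### The collapse (moved)

The named fact `Literature.Computability.Complexity.EOPL_eq_PLS_inter_PPAD` (Göös–Hollender–Jain–
Maystre–Pires–Robere–Tao 2022, Thm. 1: `EOPL = PLS ∩ PPAD`) and its two corollaries
`EOPL_eq_PLS_inter_PPAD.mem_PLS_and_mem_PPAD`, `EOPL_eq_PLS_inter_PPAD.reducible_endOfPotentialLine`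
now live in `Literature/Computability/Complexity/TFNPCollapse.lean` (refactor `wi-38313`: this file is a
definitions file and stays free of unproved named facts, so that importing the TFNP classes does not put
the collapse into a route's module cone). -/

end Literature.Computability.Complexity

/-! ## Appendix: `EOPL ⊆ PPAD` by forgetting the potential; downward closure of the classes

The elementary inclusion `EOPL ⊆ PPAD` of the collapse above, PROVED: the many-one reduction
`END-OF-POTENTIAL-LINE ≤ₘ END-OF-LINE` that forgets the potential circuit (Fearnley–Gordon–Mehta–
Savani 2020, §2: "By definition the problem lies in PPAD ∩ PLS, since one can simply ignore
solutions of type R2 to obtain an END-OF-LINE instance"), and the one-line API by which routes use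
the classes (downward closure under `≤ₘ` inside `TFNP`; solvability in `FP` under `NP ⊆ P`,
Megiddo–Papadimitriou 1991, p. 318 / Thm. 2.1). The other elementary inclusion `EOPL ⊆ PLS`
(a reduction to LOCALOPT reversing the potential) is not vendored here.

References (appendix): J. Fearnley, S. Gordon, R. Mehta, R. Savani, *Unique end of potential
line*, JCSS 114 (2020) = arXiv:1811.03841, §2 [FearnleyGordonMehtaSavani2020];
C. H. Papadimitriou, *On the complexity of the parity argument and other inefficient proofs of
existence*, JCSS 48 (1994), §2 [Papadimitriou1994Parity]; N. Megiddo, C. H. Papadimitriou, *On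
total functions, existence theorems and computational complexity*, TCS 81 (1991), p. 318 and
Thm. 2.1 [MegiddoPapadimitriou1991]; S. Arora, B. Barak, *Computational Complexity* (2009),
Thm. 2.8.
-/

namespace Literature.Computability.Complexity

open _root_.Computability

namespace TFNP

/-! ### Forgetting the potential: `EndOfPotentialLine ≤ₘ EndOfLine` -/

/-- The instance map `⟨1ⁿ, [S, P, V]⟩ ↦ ⟨1ⁿ, [S, P]⟩`, assembled from the pair projections and the
fan-out (`fanoutFn f g z = ⟨f z, g z⟩`). [FGMS 2020, §2 ("ignore solutions of type R2 to obtain an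
END-OF-LINE instance")] [cite: FearnleyGordonMehtaSavani2020, §2] -/
noncomputable def EndOfPotentialLine.forgetFn : List Bool → List Bool :=
  fanoutFn (fun z => (boolUnpair z).1)
    (fanoutFn (fun z => (boolUnpair (boolUnpair z).2).1)
      (fanoutFn (fun z => (boolUnpair (boolUnpair (boolUnpair z).2).2).1) fun _ => []))

/-- `forgetFn ∈ FP` (composition of pair projections, fan-outs and a constant).
[Arora–Barak 2009, Thm. 2.8 (proof: composition)] [folklore] -/
theorem EndOfPotentialLine.forgetFn_mem_FP : EndOfPotentialLine.forgetFn ∈ FP :=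
  fanoutFn_mem_FP boolUnpairFst_mem_FP (fanoutFn_mem_FP
    (comp_mem_FP (g := fun z => (boolUnpair z).1) boolUnpairFst_mem_FP boolUnpairSnd_mem_FP)
    (fanoutFn_mem_FP (comp_mem_FP (g := fun z => (boolUnpair z).1) boolUnpairFst_mem_FP
      (comp_mem_FP (g := fun z => (boolUnpair z).2) boolUnpairSnd_mem_FP boolUnpairSnd_mem_FP))
      (const_mem_FP [])))

/-- `forgetFn ⟨1ⁿ, [S, P, V]⟩ = ⟨1ⁿ, [S, P]⟩`. [folklore] -/
theorem EndOfPotentialLine.forgetFn_instCode (n : ℕ) (S P V : List (List Bool)) :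
    EndOfPotentialLine.forgetFn (instCode n [S, P, V]) = instCode n [S, P] := by
  simp [EndOfPotentialLine.forgetFn, instCode, fanoutFn_apply, boolUnpair_boolPair, encList_cons]

/-- **`END-OF-POTENTIAL-LINE ≤ₘ END-OF-LINE`**: forget the potential; the END-OF-LINE instance
`(S, P)` is valid when `(S, P, V)` is, and each of its solutions is a solution of type R1 of the
END-OF-POTENTIAL-LINE instance. [FGMS 2020, §2 ("By definition the problem lies in PPAD ∩ PLS,
since one can simply ignore solutions of type R2 to obtain an END-OF-LINE instance")]
[cite: FearnleyGordonMehtaSavani2020, §2] -/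
theorem EndOfPotentialLine.manyOneReducible_endOfLine :
    EndOfPotentialLine.ManyOneReducible EndOfLine := by
  refine ⟨EndOfPotentialLine.forgetFn, EndOfPotentialLine.forgetFn_mem_FP,
    fun z => (boolUnpair z).2, boolUnpairSnd_mem_FP, ?_⟩
  rintro z ⟨n, Cs, rfl, hV⟩
  match Cs, hV with
  | [S, P, V], hV =>
    obtain ⟨hS, hP, hP0, hS0, -⟩ := hV
    rw [EndOfPotentialLine.forgetFn_instCode]
    refine ⟨instCode_mem_ofCircuits_valid.2 ⟨hS, hP, hP0, hS0⟩, fun y hy => ?_⟩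
    simp only [boolUnpair_boolPair]
    have hy' : EndOfLine.IsSolution n [S, P] y := boolPair_instCode_mem_ofCircuits_rel.1 hy
    refine boolPair_instCode_mem_ofCircuits_rel.2 ?_
    simp only [EndOfLine.IsSolution, EndOfPotentialLine.IsSolution] at hy' ⊢
    exact ⟨hy'.1, by tauto⟩

end TFNP

/-- **`EOPL ⊆ PPAD`** (forget the potential: `EndOfPotentialLine ≤ₘ EndOfLine`, and `closureOf`
is monotone along reductions) — the `PPAD` half of the elementary inclusion `EOPL ⊆ PLS ∩ PPAD`
of `EOPL_eq_PLS_inter_PPAD`, proved. [FGMS 2020, §2 ("By definition the problem lies in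
PPAD ∩ PLS")] [cite: FearnleyGordonMehtaSavani2020, §2] -/
theorem EOPL_subset_PPAD : EOPL ⊆ PPAD :=
  TFNP.closureOf_mono TFNP.EndOfPotentialLine.manyOneReducible_endOfLine

/-- `PPAD` is closed downwards under many-one reductions inside `TFNP`. [Papadimitriou 1994, §2
("PPAD is the class of all TFNP problems reducible to …")] [cite: Papadimitriou1994Parity, §2] -/
theorem mem_PPAD_of_manyOneReducible {R S : SearchProblem} (hR : R ∈ TFNP)
    (h : R.ManyOneReducible S) (hS : S ∈ PPAD) : R ∈ PPAD :=
  TFNP.mem_closureOf_of_manyOneReducible hR h hS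

/-- `PLS` is closed downwards under many-one reductions inside `TFNP`. [FGHS 2022, §3.1.2]
[cite: FearnleyGoldbergHollenderSavani2022, §3.1.2] -/
theorem mem_PLS_of_manyOneReducible {R S : SearchProblem} (hR : R ∈ TFNP)
    (h : R.ManyOneReducible S) (hS : S ∈ PLS) : R ∈ PLS :=
  TFNP.mem_closureOf_of_manyOneReducible hR h hS

/-- `EOPL` is closed downwards under many-one reductions inside `TFNP`. [FGMS 2020, §2]
[cite: FearnleyGordonMehtaSavani2020, §2] -/
theorem mem_EOPL_of_manyOneReducible {R S : SearchProblem} (hR : R ∈ TFNP)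
    (h : R.ManyOneReducible S) (hS : S ∈ EOPL) : R ∈ EOPL :=
  TFNP.mem_closureOf_of_manyOneReducible hR h hS

/-- `P = NP` collapses the syntactic subclasses into `FP`: under `NP ⊆ P` every problem of `PPAD`
(likewise `PLS`, `EOPL`, all inside `TFNP`) is solvable in `FP` — so a `PneNP` route may take
"`X ∈ PPAD` and `X` is not solvable in `FP`" as its thesis. [Megiddo–Papadimitriou 1991, p. 318
and Thm. 2.1; Papadimitriou 1994, §2, Prop. 1] [cite: MegiddoPapadimitriou1991, p. 318] -/
theorem solvableInFP_of_mem_PPAD (hNP : Nondeterministic.NP ⊆ Classes.P) {R : SearchProblem}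
    (hR : R ∈ PPAD) : R.SolvableInFP :=
  SearchProblem.solvableInFP_of_mem_TFNP hNP (PPAD_subset_TFNP hR)

/-- Under `NP ⊆ P` every `EOPL` problem is solvable in `FP`. [Megiddo–Papadimitriou 1991, p. 318
and Thm. 2.1] [cite: MegiddoPapadimitriou1991, p. 318] -/
theorem solvableInFP_of_mem_EOPL (hNP : Nondeterministic.NP ⊆ Classes.P) {R : SearchProblem}
    (hR : R ∈ EOPL) : R.SolvableInFP :=
  SearchProblem.solvableInFP_of_mem_TFNP hNP (EOPL_subset_TFNP hR)

end Literature.Computability.Complexity
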